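import Summits.Parity.GeneralizedHardyLittlewood.Theorems.PrimeLevelFamEdgeIdeaDeltasPeterssonLayersSplit
import HarnessLib

/-!
# Route `PrimeLevelFamEdge`, crux K_A `MomentsBeyondDiagonal` (stmt-Parity-20007), line «petersson_layers» v4:
# HECKE REINDEXING of the spectral sum — the divisors `d₁, d₂` OUTERMOST, primed variables inside

Deck 21a's `spectralSum q P Q Δ' κ` (hence `diagPart`, every `layer q P Q Δ' r`, the heart, the bands, the far
layers) sums, at orders `(i, j)`, over the AFE box `n₁, n₂ ≤ q²`, the mollifier `m₁, m₂ ≤ M = ⌊q̂^{Δ'}⌋`, and Hecke's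
divisors `dᵢ ∣ (mᵢ, nᵢ)`, the kernel being evaluated at `(m₁n₁/d₁², m₂n₂/d₂²)`.  Writing `mᵢ = dᵢmᵢ'`, `nᵢ = dᵢnᵢ'`
the kernel arguments become the honest products `(m₁'n₁', m₂'n₂')` and the sum becomes, for EVERY kernel `κ`,

  `Σ_{i,j} c_{ij} q̂ · Σ_{d₁ ≤ M} Σ_{m₁' ≤ M/d₁} Σ_{n₁' ≤ q²/d₁} Σ_{d₂ ≤ M} Σ_{m₂' ≤ M/d₂} Σ_{n₂' ≤ q²/d₂}
      w_{ij}(d₁n₁', d₂n₂') · x_{d₁m₁'} x_{d₂m₂'} · κ(m₁'n₁', m₂'n₂')`          (`spectralSum_eq_sum_divisors_outer`)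

(an identity of finite sums: `{(n, m, d) : d ∣ (m, n)} ↔ {(d, m', n')}` coordinatewise, `sum_sum_divisors_gcd_reindex`).
This is the form in which a Petersson layer `K_r` (kernel `κ = layerKernel q r`, a Kloosterman–Bessel term at
`(m₁'n₁', m₂'n₂'; qr)`) is regrouped as a BILINEAR Kloosterman form — in `(a, b) = (m₁'n₁', m₂'n₂')` or, via the
companion identity `kloostermanSum_mul_mul_swap_of_coprime` (`…LayersKloostermanProduct`), in the balanced variables
`(u, v) = (m₁'m₂', n₁'n₂')` — for the print band of `stub_farP` (Pascadi Thm 7.1) and for `stub_band` / `stub_core`.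
Proof only (def-free helper); no layer is bounded here; K_A NOT proved; nothing about Landau–Siegel zeros.
-/

noncomputable section

open Finset Polynomial
open Literature.NumberTheory.LFunctions

namespace Summit.Parity.GeneralizedHardyLittlewood.Theorems.MomentsBeyondDiagonal.Layers

open Summit.Parity.GeneralizedHardyLittlewood.Theorems.PrimeLevelFamEdgeIdeaDeltas.PeterssonLayers

/-! ## §1. One coordinate: `Σ_{n ≤ N} Σ_{m ≤ M} Σ_{d ∣ (m,n)} f(m,n,d) = Σ_{d ≤ M} Σ_{m' ≤ M/d} Σ_{n' ≤ N/d} f(dm', dn', d)` -/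

/-- The multiples of `d ≥ 1` in `[1, M]` are `d·[1, M/d]`. [folklore] -/
theorem filter_dvd_Icc_eq_image {d : ℕ} (hd : 0 < d) (M : ℕ) :
    (Icc 1 M).filter (fun m ↦ d ∣ m) = (Icc 1 (M / d)).image (fun m' ↦ d * m') := by
  ext m
  simp only [mem_filter, mem_Icc, mem_image]
  constructor
  · rintro ⟨⟨h1, h2⟩, ⟨m', rfl⟩⟩
    refine ⟨m', ⟨?_, ?_⟩, rfl⟩
    · rcases Nat.eq_zero_or_pos m' with h | h
      · simp [h] at h1
      · exact h
    · exact (Nat.le_div_iff_mul_le hd).mpr (by rwa [mul_comm] at h2)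
  · rintro ⟨m', ⟨h1, h2⟩, rfl⟩
    refine ⟨⟨Nat.mul_pos hd h1, ?_⟩, dvd_mul_right d m'⟩
    have := (Nat.le_div_iff_mul_le hd).mp h2
    rwa [mul_comm] at this

/-- Summing over the multiples of `d ≥ 1` in `[1, M]`: `Σ_{m ≤ M, d ∣ m} g(m) = Σ_{m' ≤ M/d} g(dm')`. [folklore] -/
theorem sum_filter_dvd_Icc_eq {d : ℕ} (hd : 0 < d) (M : ℕ) (g : ℕ → ℂ) :
    ∑ m ∈ (Icc 1 M).filter (fun m ↦ d ∣ m), g m = ∑ m' ∈ Icc 1 (M / d), g (d * m') := by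
  rw [filter_dvd_Icc_eq_image hd, sum_image]
  intro a _ b _ h
  exact Nat.eq_of_mul_eq_mul_left hd h

/-- The divisors of `(m, n)` (`1 ≤ m ≤ M`) are the `d ∈ [1, M]` with `d ∣ m`, `d ∣ n`. [folklore] -/
theorem sum_divisors_gcd_eq_sum_filter {m n M : ℕ} (hm : m ∈ Icc 1 M) (f : ℕ → ℂ) :
    ∑ d ∈ (Nat.gcd m n).divisors, f d = ∑ d ∈ (Icc 1 M).filter (fun d ↦ d ∣ m ∧ d ∣ n), f d := by
  rw [mem_Icc] at hm
  refine Finset.sum_congr ?_ fun _ _ ↦ rfl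
  ext d
  simp only [Nat.mem_divisors, mem_filter, mem_Icc, Nat.dvd_gcd_iff]
  constructor
  · rintro ⟨⟨hdm, hdn⟩, hg⟩
    refine ⟨⟨Nat.pos_of_dvd_of_pos hdm (by omega), (Nat.le_of_dvd (by omega) hdm).trans hm.2⟩, hdm, hdn⟩
  · rintro ⟨⟨h1, _⟩, hdm, hdn⟩
    exact ⟨⟨hdm, hdn⟩, fun h ↦ by
      have := Nat.eq_zero_of_gcd_eq_zero_left h; omega⟩

/-- **Hecke reindexing, one coordinate**: for `f : ℕ → ℕ → ℕ → ℂ`,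
`Σ_{n ≤ N} Σ_{m ≤ M} Σ_{d ∣ (m, n)} f(m, n, d) = Σ_{d ≤ M} Σ_{m' ≤ M/d} Σ_{n' ≤ N/d} f(dm', dn', d)`. [folklore] -/
theorem sum_sum_divisors_gcd_reindex (N M : ℕ) (f : ℕ → ℕ → ℕ → ℂ) :
    ∑ n ∈ Icc 1 N, ∑ m ∈ Icc 1 M, ∑ d ∈ (Nat.gcd m n).divisors, f m n d =
      ∑ d ∈ Icc 1 M, ∑ m' ∈ Icc 1 (M / d), ∑ n' ∈ Icc 1 (N / d), f (d * m') (d * n') d := by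
  classical
  -- divisors → filtered interval
  have h1 : ∑ n ∈ Icc 1 N, ∑ m ∈ Icc 1 M, ∑ d ∈ (Nat.gcd m n).divisors, f m n d =
      ∑ n ∈ Icc 1 N, ∑ m ∈ Icc 1 M, ∑ d ∈ Icc 1 M, if d ∣ m ∧ d ∣ n then f m n d else 0 := by
    refine sum_congr rfl fun n _ ↦ sum_congr rfl fun m hm ↦ ?_
    rw [sum_divisors_gcd_eq_sum_filter hm, sum_filter]
  rw [h1]
  -- `d` outermost
  rw [sum_comm]
  rw [sum_congr rfl fun m _ ↦ sum_comm]
  rw [sum_comm]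
  refine sum_congr rfl fun d hd ↦ ?_
  have hd0 : 0 < d := (mem_Icc.mp hd).1
  -- now `Σ_m Σ_n [d ∣ m ∧ d ∣ n] f m n d`
  have h2 : ∀ m ∈ Icc 1 M, ∑ n ∈ Icc 1 N, (if d ∣ m ∧ d ∣ n then f m n d else 0) =
      if d ∣ m then ∑ n ∈ (Icc 1 N).filter (fun n ↦ d ∣ n), f m n d else 0 := by
    intro m _
    by_cases hdm : d ∣ m
    · rw [if_pos hdm, sum_filter]
      exact sum_congr rfl fun n _ ↦ by simp [hdm]
    · rw [if_neg hdm]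
      exact sum_eq_zero fun n _ ↦ by simp [hdm]
  rw [sum_congr rfl h2, ← sum_filter, sum_filter_dvd_Icc_eq hd0]
  refine sum_congr rfl fun m' _ ↦ ?_
  rw [sum_filter_dvd_Icc_eq hd0]

/-- The kernel argument in primed variables: `(dm')(dn')/d² = m'n'` (`d ≥ 1`). [folklore] -/
theorem mul_mul_div_sq {d : ℕ} (hd : 0 < d) (m' n' : ℕ) : d * m' * (d * n') / d ^ 2 = m' * n' := by
  rw [show d * m' * (d * n') = d ^ 2 * (m' * n') by ring]
  exact Nat.mul_div_cancel_left _ (pow_pos hd 2)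

/-! ## §2. The spectral sum with the divisors outermost -/

variable (q : ℕ) [NeZero q]

omit [NeZero q] in
/-- **The spectral sum, Hecke-reindexed** (both coordinates; every kernel `κ`): divisors `d₁, d₂ ≤ M` outermost,
then `mᵢ' ≤ M/dᵢ`, `nᵢ' ≤ q²/dᵢ`, weights at `(dᵢnᵢ', dᵢmᵢ')`, kernel at the products `(m₁'n₁', m₂'n₂')`.
[cite: KowalskiMichelVanderKam2000, §5 p. 13 (Hecke's recursion (10) applied to the second moment)] -/
theorem spectralSum_eq_sum_divisors_outer (P Q : ℝ[X]) (Δ' : ℝ) (κ : ℕ → ℕ → ℂ) :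
    spectralSum q P Q Δ' κ =
      ∑ i ∈ range (Q.natDegree + 1), ∑ j ∈ range (Q.natDegree + 1),
        (Q.coeff i : ℂ) * (Q.coeff j : ℂ) * (((Real.log (KMV2000.qhat q))⁻¹ : ℝ) : ℂ) ^ (i + j) *
          (1 + (-1 : ℂ) ^ (i + j)) * (KMV2000.qhat q : ℂ) *
        ∑ d₁ ∈ Icc 1 ⌊KMV2000.qhat q ^ Δ'⌋₊, ∑ m₁ ∈ Icc 1 (⌊KMV2000.qhat q ^ Δ'⌋₊ / d₁), ∑ n₁ ∈ Icc 1 (q ^ 2 / d₁),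
        ∑ d₂ ∈ Icc 1 ⌊KMV2000.qhat q ^ Δ'⌋₊, ∑ m₂ ∈ Icc 1 (⌊KMV2000.qhat q ^ Δ'⌋₊ / d₂), ∑ n₂ ∈ Icc 1 (q ^ 2 / d₂),
          ((((((d₁ * n₁ : ℕ) : ℝ) * ((d₂ * n₂ : ℕ) : ℝ)) ^ (-(1 / 2 : ℝ)) : ℝ) : ℂ) *
              afeW (KMV2000.qhat q) i j (d₁ * n₁) (d₂ * n₂)) *
            ((KMV2000.mollifierCoeff P (KMV2000.qhat q ^ Δ') (d₁ * m₁) : ℂ) *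
              (KMV2000.mollifierCoeff P (KMV2000.qhat q ^ Δ') (d₂ * m₂) : ℂ) *
              κ (m₁ * n₁) (m₂ * n₂)) := by
  unfold spectralSum afeBox
  refine sum_congr rfl fun i _ ↦ sum_congr rfl fun j _ ↦ ?_
  congr 1
  set Mf : ℕ := ⌊KMV2000.qhat q ^ Δ'⌋₊ with hMf
  set M : ℝ := KMV2000.qhat q ^ Δ' with hM
  -- Step 0: distribute into a single summand, order (n₁, n₂, m₁, m₂, d₁, d₂)
  simp only [Finset.mul_sum]
  -- Step 1: reorder to (n₁, m₁, d₁, n₂, m₂, d₂)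
  rw [sum_congr rfl fun n₁ _ ↦ sum_comm]
  rw [sum_congr rfl fun n₁ _ ↦ sum_congr rfl fun m₁ _ ↦ sum_congr rfl fun n₂ _ ↦ sum_comm]
  rw [sum_congr rfl fun n₁ _ ↦ sum_congr rfl fun m₁ _ ↦ sum_comm]
  -- Step 2: reindex coordinate 1, then coordinate 2 inside
  rw [sum_sum_divisors_gcd_reindex]
  refine sum_congr rfl fun d₁ hd₁ ↦ sum_congr rfl fun m₁ _ ↦ sum_congr rfl fun n₁ _ ↦ ?_
  rw [sum_sum_divisors_gcd_reindex]
  refine sum_congr rfl fun d₂ hd₂ ↦ sum_congr rfl fun m₂ _ ↦ sum_congr rfl fun n₂ _ ↦ ?_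
  -- Step 3: the kernel arguments
  rw [mul_mul_div_sq (mem_Icc.mp hd₁).1, mul_mul_div_sq (mem_Icc.mp hd₂).1]

/-- **Every Petersson layer, Hecke-reindexed**: `K_r = layer q P Q Δ' r` in primed variables with the
Kloosterman–Bessel kernel at `(m₁'n₁', m₂'n₂'; qr)`. [cite: KowalskiMichelVanderKam2000, §5 p. 13] -/
theorem layer_eq_sum_divisors_outer (P Q : ℝ[X]) (Δ' : ℝ) (r : ℕ) :
    layer q P Q Δ' r =
      ∑ i ∈ range (Q.natDegree + 1), ∑ j ∈ range (Q.natDegree + 1),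
        (Q.coeff i : ℂ) * (Q.coeff j : ℂ) * (((Real.log (KMV2000.qhat q))⁻¹ : ℝ) : ℂ) ^ (i + j) *
          (1 + (-1 : ℂ) ^ (i + j)) * (KMV2000.qhat q : ℂ) *
        ∑ d₁ ∈ Icc 1 ⌊KMV2000.qhat q ^ Δ'⌋₊, ∑ m₁ ∈ Icc 1 (⌊KMV2000.qhat q ^ Δ'⌋₊ / d₁), ∑ n₁ ∈ Icc 1 (q ^ 2 / d₁),
        ∑ d₂ ∈ Icc 1 ⌊KMV2000.qhat q ^ Δ'⌋₊, ∑ m₂ ∈ Icc 1 (⌊KMV2000.qhat q ^ Δ'⌋₊ / d₂), ∑ n₂ ∈ Icc 1 (q ^ 2 / d₂),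
          ((((((d₁ * n₁ : ℕ) : ℝ) * ((d₂ * n₂ : ℕ) : ℝ)) ^ (-(1 / 2 : ℝ)) : ℝ) : ℂ) *
              afeW (KMV2000.qhat q) i j (d₁ * n₁) (d₂ * n₂)) *
            ((KMV2000.mollifierCoeff P (KMV2000.qhat q ^ Δ') (d₁ * m₁) : ℂ) *
              (KMV2000.mollifierCoeff P (KMV2000.qhat q ^ Δ') (d₂ * m₂) : ℂ) *
              layerKernel q r (m₁ * n₁) (m₂ * n₂)) :=
  spectralSum_eq_sum_divisors_outer q P Q Δ' (layerKernel q r)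

/-! ## Appendix (same seat, same day): both divisors first — blocks at fixed `(d₁, d₂)`

For the bilinear packaging one wants the two divisors `d₁, d₂` OUTERMOST TOGETHER, so that at fixed `(d₁, d₂)` the inner block
is a sum over `(m₁', n₁', m₂', n₂')` alone.  Order `(d₁, d₂, m₁', n₁', m₂', n₂')`. -/

omit [NeZero q] in
/-- **The spectral sum with BOTH divisors outermost** (order `d₁, d₂, m₁', n₁', m₂', n₂'`; every kernel `κ`).
[cite: KowalskiMichelVanderKam2000, §5 p. 13] -/
theorem spectralSum_eq_sum_divisors_first (P Q : ℝ[X]) (Δ' : ℝ) (κ : ℕ → ℕ → ℂ) :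
    spectralSum q P Q Δ' κ =
      ∑ i ∈ range (Q.natDegree + 1), ∑ j ∈ range (Q.natDegree + 1),
        (Q.coeff i : ℂ) * (Q.coeff j : ℂ) * (((Real.log (KMV2000.qhat q))⁻¹ : ℝ) : ℂ) ^ (i + j) *
          (1 + (-1 : ℂ) ^ (i + j)) * (KMV2000.qhat q : ℂ) *
        ∑ d₁ ∈ Icc 1 ⌊KMV2000.qhat q ^ Δ'⌋₊, ∑ d₂ ∈ Icc 1 ⌊KMV2000.qhat q ^ Δ'⌋₊,
        ∑ m₁ ∈ Icc 1 (⌊KMV2000.qhat q ^ Δ'⌋₊ / d₁), ∑ n₁ ∈ Icc 1 (q ^ 2 / d₁),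
        ∑ m₂ ∈ Icc 1 (⌊KMV2000.qhat q ^ Δ'⌋₊ / d₂), ∑ n₂ ∈ Icc 1 (q ^ 2 / d₂),
          ((((((d₁ * n₁ : ℕ) : ℝ) * ((d₂ * n₂ : ℕ) : ℝ)) ^ (-(1 / 2 : ℝ)) : ℝ) : ℂ) *
              afeW (KMV2000.qhat q) i j (d₁ * n₁) (d₂ * n₂)) *
            ((KMV2000.mollifierCoeff P (KMV2000.qhat q ^ Δ') (d₁ * m₁) : ℂ) *
              (KMV2000.mollifierCoeff P (KMV2000.qhat q ^ Δ') (d₂ * m₂) : ℂ) *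
              κ (m₁ * n₁) (m₂ * n₂)) := by
  rw [spectralSum_eq_sum_divisors_outer]
  refine sum_congr rfl fun i _ ↦ sum_congr rfl fun j _ ↦ ?_
  congr 1
  refine sum_congr rfl fun d₁ _ ↦ ?_
  -- move `d₂` left past `n₁` and `m₁`
  rw [sum_congr rfl fun m₁ _ ↦ sum_comm]
  rw [sum_comm]

/-- **Every Petersson layer with both divisors outermost.** [cite: KowalskiMichelVanderKam2000, §5 p. 13] -/
theorem layer_eq_sum_divisors_first (P Q : ℝ[X]) (Δ' : ℝ) (r : ℕ) :
    layer q P Q Δ' r =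
      ∑ i ∈ range (Q.natDegree + 1), ∑ j ∈ range (Q.natDegree + 1),
        (Q.coeff i : ℂ) * (Q.coeff j : ℂ) * (((Real.log (KMV2000.qhat q))⁻¹ : ℝ) : ℂ) ^ (i + j) *
          (1 + (-1 : ℂ) ^ (i + j)) * (KMV2000.qhat q : ℂ) *
        ∑ d₁ ∈ Icc 1 ⌊KMV2000.qhat q ^ Δ'⌋₊, ∑ d₂ ∈ Icc 1 ⌊KMV2000.qhat q ^ Δ'⌋₊,
        ∑ m₁ ∈ Icc 1 (⌊KMV2000.qhat q ^ Δ'⌋₊ / d₁), ∑ n₁ ∈ Icc 1 (q ^ 2 / d₁),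
        ∑ m₂ ∈ Icc 1 (⌊KMV2000.qhat q ^ Δ'⌋₊ / d₂), ∑ n₂ ∈ Icc 1 (q ^ 2 / d₂),
          ((((((d₁ * n₁ : ℕ) : ℝ) * ((d₂ * n₂ : ℕ) : ℝ)) ^ (-(1 / 2 : ℝ)) : ℝ) : ℂ) *
              afeW (KMV2000.qhat q) i j (d₁ * n₁) (d₂ * n₂)) *
            ((KMV2000.mollifierCoeff P (KMV2000.qhat q ^ Δ') (d₁ * m₁) : ℂ) *
              (KMV2000.mollifierCoeff P (KMV2000.qhat q ^ Δ') (d₂ * m₂) : ℂ) *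
              layerKernel q r (m₁ * n₁) (m₂ * n₂)) :=
  spectralSum_eq_sum_divisors_first q P Q Δ' (layerKernel q r)

end Summit.Parity.GeneralizedHardyLittlewood.Theorems.MomentsBeyondDiagonal.Layers

end
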